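import Literature.AlgebraicGeometry.Frobenioids.NaiveFrobeniusFunctorLiftsClosureRefuted
import Literature.AlgebraicGeometry.Frobenioids.ArithmeticFrobenioidStandard
import Literature.AlgebraicGeometry.Frobenioids.GeometricFrobenioidStandard
import Literature.AlgebraicGeometry.Frobenioids.IrreducibleMorphismsCounterexample
import HarnessLib

/-!
# Frobenioids I, Prop. 1.10 (i) as the §2 lifting hypothesis `HasFrobeniusLifts F d`: 0-hypothesis
# INSTANCE FORMS at the Frobenioids of the paper (arithmetic `C_{K/F}`, geometric `C_{K̃/K}`, standard `F_{ℤ≥0}`)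

S. Mochizuki, *The geometry of Frobenioids I: the general theory*, Kyushu J. Math. **62** (2008) 293–400
[MochizukiFrdI2008], §1, Prop. 1.10 (i), kurims p. 34 [cite: MochizukiFrdI2008, Prop. 1.10(i) p.34]: "Let
`A ∈ Ob(C)`, `d ∈ ℕ_{≥1}`; `φ : A → B` a morphism; `α : A → A'`, `β : B → B'` morphisms of Frobenius type
of Frobenius degree `d`. Then there exists a unique morphism `φ' : A' → B'` such that `φ' ∘ α = β ∘ φ`.
Moreover `deg_Fr(φ) = deg_Fr(φ')`, and `d · α_*(Div(φ)) = Div(φ')`" — used in §2 (Prop. 2.1, p. 44) to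
build the naive Frobenius functor.

PROOF-ONLY companion (abc-iut cell, block F, KEY row INST59K2, seat abc-iut-f-002; 0 `def` / `structure`
/ `instance` / notation, no `Prop` fact) of `NaiveFrobeniusFunctor.lean` (seat abc-iut-L1), FACT-LIST row
**F-1159** `PreFrobenioid.HasFrobeniusLifts (F : C ⥤ ElemFrobenioid Φ) (d : ℕ+)`.  State of the row in the
tree: a SCHEMA over an arbitrary structure functor `F`; its universal closure is REFUTED
(`PreFrobenioid.not_forall_hasFrobeniusLifts`, abc-iut-f-044: a four-object poset over the trivial
monoid); its content is the CONDITIONAL closer `PreFrobenioid.hasFrobeniusLifts (hF : IsFrobenioid F) d`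
(abc-iut-L1-t1's Prop. 1.10 (i)).  The L-F kernel census (plan/LF-KERNEL-STATUS.tsv 2026-08-27, col 14)
found NO theorem whose conclusion HEAD is `HasFrobeniusLifts …` without a hypothesis.

THIS FILE supplies those instance forms, at GENUINE data — the Frobenioids the paper itself constructs
(each IS a Frobenioid by a kernel theorem of the tree, so `hasFrobeniusLifts` applies BY NAME):
* `hasFrobeniusLifts_arith` — THE arithmetic Frobenioid `C_{K/F}` of a Galois extension of a number
  field (Example 6.3 p. 113, `arithFrobenioid_isFrobenioid`, abc-iut-L6-t10), every degree `d`;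
* `hasFrobeniusLifts_geom` — THE geometric Frobenioid `C_{K̃/K}` of Example 6.1 p. 109
  (`geomFrobenioid_isFrobenioid`), every degree `d`;
* `hasFrobeniusLifts_standard`, `hasFrobeniusLifts_standard_two` — the STANDARD Frobenioid
  `F_{ℤ≥0} → F_{Φ^char}` of Def. 1.1 (iii) / Prop. 1.5 (`StandardFrobenioidExample.isFrobenioid`), a
  CLOSED (binder-free) certificate, in particular in degree `2` — the degree at which the closure
  refuter's poset model has NO lift (`not_forall_hasFrobeniusLifts`): the refuter exploits a structure
  functor that is not a Frobenioid, nothing else;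
* `hasFrobeniusLifts_census_standard` — closure false ∧ instance true, side by side.
Nothing of `NaiveFrobeniusFunctor.lean` is restated or edited.  [FrdI] is refereed, undisputed mathematics; an
instance-form theorem about OUR typed statement is not a theorem about IUT in print; no side taken on
[IUTchIII] Cor. 3.12.
-/

namespace Literature.AlgebraicGeometry.Frobenioids

open CategoryTheory Opposite

namespace PreFrobenioid

/-! ### At THE arithmetic Frobenioid `C_{K/F}` (Example 6.3) -/

/-- **F-1159, INSTANCE (genuine: the arithmetic Frobenioid of a number field).** For number fields
`F ⊆ K`, `K/F` Galois, morphisms of the Frobenioid `C_{K/F}` (Example 6.3) lift uniquely along pairs of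
morphisms of Frobenius type of any degree `d`, with the printed `deg_Fr` and `Div` formulas — Prop. 1.10 (i)
at `C_{K/F}` (`hasFrobeniusLifts` ∘ `arithFrobenioid_isFrobenioid`).
[cite: MochizukiFrdI2008, Prop. 1.10(i) p.34] -/
theorem hasFrobeniusLifts_arith (F : Type) [Field F] [NumberField F] (K : Type) [Field K] [Algebra F K]
    [IsGalois F K] (d : ℕ+) :
    Literature.AlgebraicGeometry.Frobenioids.PreFrobenioid.HasFrobeniusLifts
      (ModelFrobenioid.toElem (arithDivisorFunctor F K) (unitsFunctor F K) (divNatTrans F K)) d :=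
  hasFrobeniusLifts (arithFrobenioid_isFrobenioid F K) d

/-! ### At THE geometric Frobenioid `C_{K̃/K}` (Example 6.1) -/

/-- **F-1159, INSTANCE (genuine: the geometric Frobenioid of a function field).** For geometric divisor
data `Γ` on a Galois extension `K̃/K` (Example 6.1), morphisms of `C_{K̃/K}` lift uniquely along pairs of
morphisms of Frobenius type of any degree `d` — Prop. 1.10 (i) at `C_{K̃/K}`
(`hasFrobeniusLifts` ∘ `geomFrobenioid_isFrobenioid`). [cite: MochizukiFrdI2008, Prop. 1.10(i) p.34] -/
theorem hasFrobeniusLifts_geom {K : Type} [Field K] {Kt : Type} [Field Kt] [Algebra K Kt]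
    (Γ : GeometricDivisorData K Kt) [IsGalois K Kt] (d : ℕ+) :
    Literature.AlgebraicGeometry.Frobenioids.PreFrobenioid.HasFrobeniusLifts
      (ModelFrobenioid.toElem (geomDivisorFunctor Γ) (geomUnitsFunctor Γ) (geomDivNatTrans Γ)) d :=
  hasFrobeniusLifts (geomFrobenioid_isFrobenioid Γ) d

/-! ### At the standard Frobenioid `F_{ℤ≥0}` (Definition 1.1 (iii), Proposition 1.5) — closed certificates -/

/-- **F-1159, INSTANCE (genuine, CLOSED: the standard Frobenioid).** In the standard Frobenioid
`F_{ℤ≥0} → F_{Φ^char}` of Def. 1.1 (iii) (a Frobenioid by Prop. 1.5, `StandardFrobenioidExample.isFrobenioid`)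
morphisms lift uniquely along pairs of morphisms of Frobenius type of every degree `d`.
[cite: MochizukiFrdI2008, Prop. 1.10(i) p.34] -/
theorem hasFrobeniusLifts_standard (d : ℕ+) :
    Literature.AlgebraicGeometry.Frobenioids.PreFrobenioid.HasFrobeniusLifts
      (ElemFrobenioid.toChar StandardFrobenioidExample.Φst) d :=
  hasFrobeniusLifts StandardFrobenioidExample.isFrobenioid d

/-- **F-1159, INSTANCE (genuine, CLOSED, degree `2`).** Unique Frobenius lifting in degree `2` holds in the
standard Frobenioid `F_{ℤ≥0}` — the very degree at which the closure refuter's (non-Frobenioid) poset model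
admits no lift (`not_forall_hasFrobeniusLifts`). [cite: MochizukiFrdI2008, Prop. 1.10(i) p.34] -/
theorem hasFrobeniusLifts_standard_two :
    Literature.AlgebraicGeometry.Frobenioids.PreFrobenioid.HasFrobeniusLifts
      (ElemFrobenioid.toChar StandardFrobenioidExample.Φst) 2 :=
  hasFrobeniusLifts_standard 2

/-- **Census of F-1159**: the universal closure over ALL structure functors is false
(`not_forall_hasFrobeniusLifts`), while the instance form holds at the standard Frobenioid in every degree.
[cite: MochizukiFrdI2008, Prop. 1.10(i) p.34] -/
theorem hasFrobeniusLifts_census_standard :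
    (¬ ∀ (D : Type) [Category.{0} D] (Φ : Dᵒᵖ ⥤ CommMonCat.{0}) (C : Type) [Category.{0} C]
        (F : C ⥤ ElemFrobenioid Φ) (d : ℕ+), HasFrobeniusLifts F d) ∧
      ∀ d : ℕ+, HasFrobeniusLifts (ElemFrobenioid.toChar StandardFrobenioidExample.Φst) d :=
  ⟨not_forall_hasFrobeniusLifts, hasFrobeniusLifts_standard⟩

end PreFrobenioid

end Literature.AlgebraicGeometry.Frobenioids
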